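import Summits.BirchSwinnertonDyer.BirchSwinnertonDyer.Theorems.Rank2ObservatoryRank3SatCertB
import Summits.BirchSwinnertonDyer.BirchSwinnertonDyer.Theorems.Rank2ObservatoryRank3Table
import Summits.BirchSwinnertonDyer.BirchSwinnertonDyer.Theorems.Rank2ObservatoryTorsionCert
import Literature.NumberTheory.EllipticCurves.VariableChangePointsMap
import HarnessLib

/-!
# BirchSwinnertonDyer — rank ≥ 2 observatory: the rank-3 SATURATION certificate, II (rows)

HONEST FRAMING: per-curve certified theorems and census instruments; no claim on BSD in rank ≥ 2.

Sequel of `Rank2ObservatoryRank3SatCertB.lean` (the kernel Booleans `killerB`, `witnessB`,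
`witness₂B`, `witness₃B` and `twoSaturated_of_certB` on an integral model). Here the certificate is
attached to a ROW of the rank-3 table (`Rank3Row`, `Rank2ObservatoryRank3Table.lean`):

* `Rank3SatCert` — the per-row certificate record (pure data): scale `d`, the scaled integral
  coordinates `(Xᵢ, Yᵢ)` of the listed generators, kernel counts `S`, annihilator `t = 2^u·m`,
  the seven witness primes and the chord residues;
* `rank3SatCheck r c` — the row Boolean (kernel `decide`): the coordinates match the row's
  projective generators `[X:Y:Z] ↦ (d²X/Z, d³Y/Z)`, the integral equations on
  `scaleModel r.intModel d`, annihilator, killers, seven witnesses;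
* `Rank3Row.twoSaturated_of_satCheck` — SOUNDNESS: in `E(ℚ) = r.curve⟮ℚ⟯` the listed span
  `ℤP₁ + ℤP₂ + ℤP₃ + E(ℚ)_tors` of `r.gen₁ h, r.gen₂ h, r.gen₃ h` is `2`-SATURATED and the
  generators are `ℤ`-independent — transported from the scaled model along the isomorphism
  `E(ℚ) ≃+ V⟮ℚ⟯` of the change of variables `(x, y) ↦ (d²x, d³y)` (`VariableChange.pointEquiv`,
  `map_scaleModel_eq_smul`, `Affine.Point.congrEquiv`; `two_saturated_map`,
  `linearIndependent_triple_map` of `Rank2ObservatoryListedSpan.lean`);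
* `Rank3Row.finiteIndex_and_odd_index_of_twoSaturated` — with `rank_ℤ E(ℚ) = 3` (the census
  `Rank2ObservatoryRank3KernelRankCensusN9365.rank_eq_three`, 9 365 rows; Mordell–Weil is proved in
  the tree) the listed span has finite ODD index: `Reg(P₁,P₂,P₃) = n²·Reg(E(ℚ)/tors)`, `n` odd;
* `rank3SatCheckAll` / `Rank3Row.twoSaturated_of_satCheckAll` — list form for the data files
  `Rank2ObservatoryRank3SatRows*` (one `decide` per slice of rows).

Sorry-free; axioms `propext`, `Classical.choice`, `Quot.sound` only; no `native_decide`.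

References: J. E. Cremona, *Algorithms for Modular Elliptic Curves* (2nd ed. 1997), §3.5;
S. Siksek, *Infinite descent on elliptic curves*, Rocky Mountain J. Math. 25 (1995) 1501–1538;
J. H. Silverman, *The Arithmetic of Elliptic Curves* (2nd ed. 2009), III.1 (Table 3.1),
III.3.1(b), Thm. VIII.6.7.
-/

-- single-conjunct summit: `Summit.BirchSwinnertonDyer.BirchSwinnertonDyer.…` repeats the name
set_option linter.dupNamespace false

namespace Summit.BirchSwinnertonDyer.BirchSwinnertonDyer.Rank2Observatory

open WeierstrassCurve Literature.NumberTheory.EllipticCurves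

/-! ### The row certificate -/

/-- The SATURATION CERTIFICATE of a rank-3 row: the scale `d` of the integral model
`scaleModel _ d` on which the listed generators become the integral points `(Xᵢ, Yᵢ)`; the
kernel counts `S = [(ℓ, #Ẽ(𝔽_ℓ)), …]` and the torsion annihilator `t = 2^u · m`; the seven witness
primes `q₁, …, q₁₂₃` and the chord residues (`(X₁₂, Y₁₂) ≡ P₁ + P₂ (mod q₁₂)`, …,
`(X₀, Y₀) ≡ P₁ + P₂`, `(X₁₂₃, Y₁₂₃) ≡ P₁ + P₂ + P₃ (mod q₁₂₃)`). Pure data; checked by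
`rank3SatCheck`. [cite: CremonaAlgorithms1997, §3.5] -/
structure Rank3SatCert where
  /-- scale of the integral model -/
  d : ℤ
  /-- `x`-coordinate of the first scaled generator -/
  X₁ : ℤ
  /-- `y`-coordinate of the first scaled generator -/
  Y₁ : ℤ
  /-- `x`-coordinate of the second scaled generator -/
  X₂ : ℤ
  /-- `y`-coordinate of the second scaled generator -/
  Y₂ : ℤ
  /-- `x`-coordinate of the third scaled generator -/
  X₃ : ℤ
  /-- `y`-coordinate of the third scaled generator -/
  Y₃ : ℤ
  /-- kernel point counts `(ℓ, #Ẽ(𝔽_ℓ))` -/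
  S : List (ℕ × ℕ)
  /-- torsion annihilator `t = 2^u · m` -/
  t : ℕ
  /-- its `2`-exponent -/
  u : ℕ
  /-- its odd part -/
  m : ℕ
  /-- witness prime for `P₁` -/
  q₁ : ℕ
  /-- witness prime for `P₂` -/
  q₂ : ℕ
  /-- witness prime for `P₃` -/
  q₃ : ℕ
  /-- witness prime for `P₁ + P₂` -/
  q₁₂ : ℕ
  /-- witness prime for `P₁ + P₃` -/
  q₁₃ : ℕ
  /-- witness prime for `P₂ + P₃` -/
  q₂₃ : ℕ
  /-- witness prime for `P₁ + P₂ + P₃` -/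
  q₁₂₃ : ℕ
  /-- `P₁ + P₂ mod q₁₂` -/
  X₁₂ : ℤ
  /-- `P₁ + P₂ mod q₁₂` -/
  Y₁₂ : ℤ
  /-- `P₁ + P₃ mod q₁₃` -/
  X₁₃ : ℤ
  /-- `P₁ + P₃ mod q₁₃` -/
  Y₁₃ : ℤ
  /-- `P₂ + P₃ mod q₂₃` -/
  X₂₃ : ℤ
  /-- `P₂ + P₃ mod q₂₃` -/
  Y₂₃ : ℤ
  /-- `P₁ + P₂ mod q₁₂₃` -/
  X₀ : ℤ
  /-- `P₁ + P₂ mod q₁₂₃` -/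
  Y₀ : ℤ
  /-- `P₁ + P₂ + P₃ mod q₁₂₃` -/
  X₁₂₃ : ℤ
  /-- `P₁ + P₂ + P₃ mod q₁₂₃` -/
  Y₁₂₃ : ℤ

/-! The row's integer model `Rank3Row.intModel r = ⟨a₁, a₂, a₃, a₄, a₆⟩` and
`Rank3Row.curve_eq_map_intModel : r.curve = r.intModel.map (Int.castRingHom ℚ)` are imported
(`Rank2ObservatoryRank3RootNumber.lean`, `Rank2ObservatoryTorsionCert.lean`). -/

/-- **The row Boolean** (kernel `decide`): with `V = scaleModel r.intModel c.d` — `d ≠ 0`, `m` odd,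
`t = 2^u·m`; the scaled coordinates match the row's projective generators
(`Xᵢ·Z = d²·X`, `Yᵢ·Z = d³·Y` for `[X:Y:Z]`); the three integral Weierstrass equations on `V`;
`annihilatorCheck`; every entry of `S` passes `killerB V`; the seven witnesses.
[cite: CremonaAlgorithms1997, §3.5] -/
def rank3SatCheck (r : Rank3Row) (c : Rank3SatCert) : Bool :=
  let V := scaleModel r.intModel c.d
  decide (c.d ≠ 0 ∧ c.m % 2 = 1 ∧ c.t = 2 ^ c.u * c.m ∧
      c.X₁ * r.P₁.2.2 = c.d ^ 2 * r.P₁.1 ∧ c.Y₁ * r.P₁.2.2 = c.d ^ 3 * r.P₁.2.1 ∧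
      c.X₂ * r.P₂.2.2 = c.d ^ 2 * r.P₂.1 ∧ c.Y₂ * r.P₂.2.2 = c.d ^ 3 * r.P₂.2.1 ∧
      c.X₃ * r.P₃.2.2 = c.d ^ 2 * r.P₃.1 ∧ c.Y₃ * r.P₃.2.2 = c.d ^ 3 * r.P₃.2.1 ∧
      c.Y₁ ^ 2 + V.a₁ * c.X₁ * c.Y₁ + V.a₃ * c.Y₁ =
        c.X₁ ^ 3 + V.a₂ * c.X₁ ^ 2 + V.a₄ * c.X₁ + V.a₆ ∧
      c.Y₂ ^ 2 + V.a₁ * c.X₂ * c.Y₂ + V.a₃ * c.Y₂ =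
        c.X₂ ^ 3 + V.a₂ * c.X₂ ^ 2 + V.a₄ * c.X₂ + V.a₆ ∧
      c.Y₃ ^ 2 + V.a₁ * c.X₃ * c.Y₃ + V.a₃ * c.Y₃ =
        c.X₃ ^ 3 + V.a₂ * c.X₃ ^ 2 + V.a₄ * c.X₃ + V.a₆) &&
  annihilatorCheck c.S c.t && c.S.all (killerB V) &&
  witnessB V c.u c.q₁ c.X₁ c.Y₁ && witnessB V c.u c.q₂ c.X₂ c.Y₂ &&
  witnessB V c.u c.q₃ c.X₃ c.Y₃ &&
  witness₂B V c.u c.q₁₂ c.X₁ c.Y₁ c.X₂ c.Y₂ c.X₁₂ c.Y₁₂ &&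
  witness₂B V c.u c.q₁₃ c.X₁ c.Y₁ c.X₃ c.Y₃ c.X₁₃ c.Y₁₃ &&
  witness₂B V c.u c.q₂₃ c.X₂ c.Y₂ c.X₃ c.Y₃ c.X₂₃ c.Y₂₃ &&
  witness₃B V c.u c.q₁₂₃ c.X₁ c.Y₁ c.X₂ c.Y₂ c.X₀ c.Y₀ c.X₃ c.Y₃ c.X₁₂₃ c.Y₁₂₃

/-! ### Soundness: transport from the scaled model to the census equation -/

section Transport

/-- Transport of `Point.some` along equal coordinates. [folklore] -/
private theorem some_eq_some {W : Affine ℚ} {x y x' y' : ℚ} (hx : x = x') (hy : y = y')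
    {h : W.Nonsingular x y} {h' : W.Nonsingular x' y'} :
    Affine.Point.some x y h = .some x' y' h' := by
  subst hx hy
  rfl

/-- The scaled coordinate: `X'·Z = d²·X` gives `d² · (X/Z) = X'` over `ℚ`. [folklore] -/
private theorem scaled_coord {X' Z X d : ℤ} (k : ℕ) (hZ : Z ≠ 0) (h : X' * Z = d ^ k * X) :
    (d : ℚ) ^ k * ((X : ℚ) / Z) = X' := by
  have hZ' : (Z : ℚ) ≠ 0 := by exact_mod_cast hZ
  rw [← mul_div_assoc, div_eq_iff hZ']
  exact_mod_cast h.symm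

end Transport

namespace Rank3Row

/-- **SOUNDNESS of the row certificate.** If `rank3SatCheck r c = true` (and the row checks) then
in `E(ℚ) = r.curve⟮ℚ⟯` the listed span `ℤP₁ + ℤP₂ + ℤP₃ + E(ℚ)_tors` of the listed generators is
`2`-SATURATED and the generators are `ℤ`-independent: the certificate on the integral model
`V = scaleModel r.intModel d`
(`twoSaturated_of_certB`) is transported to `E(ℚ) = r.curve⟮ℚ⟯` along the isomorphism
`E(ℚ) ≃+ V⟮ℚ⟯` induced by the change of variables `(x, y) ↦ (d²x, d³y)`
(`VariableChange.pointEquiv`, `map_scaleModel_eq_smul`, `Affine.Point.congrEquiv`), which sends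
`r.genᵢ h = (X/Z, Y/Z)` to `(Xᵢ, Yᵢ)` (`two_saturated_map`, `linearIndependent_triple_map`).
[cite: CremonaAlgorithms1997, §3.5] [cite: SilvermanAEC2009, III.3.1(b)] -/
theorem twoSaturated_of_satCheck (r : Rank3Row) (h : r.check = true) (c : Rank3SatCert)
    (hc : rank3SatCheck r c = true) :
    (∀ a : r.curve.toAffine.Point,
      2 • a ∈ AddSubgroup.closure {r.gen₁ h, r.gen₂ h, r.gen₃ h} ⊔ AddCommGroup.torsion _ →
        a ∈ AddSubgroup.closure {r.gen₁ h, r.gen₂ h, r.gen₃ h} ⊔ AddCommGroup.torsion _) ∧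
    LinearIndependent ℤ ![r.gen₁ h, r.gen₂ h, r.gen₃ h] := by
  classical
  simp only [rank3SatCheck, Bool.and_eq_true, decide_eq_true_eq] at hc
  obtain ⟨⟨⟨⟨⟨⟨⟨⟨⟨⟨hd, hm, htm, hX₁, hY₁, hX₂, hY₂, hX₃, hY₃, e₁, e₂, e₃⟩, hann⟩, hS⟩, hw₁⟩,
    hw₂⟩, hw₃⟩, hw₁₂⟩, hw₁₃⟩, hw₂₃⟩, hw₁₂₃⟩ := hc
  have hΔ : (scaleModel r.intModel c.d).Δ ≠ 0 := Δ_ne_zero_of_witnessB hw₁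
  obtain ⟨hsat, hli⟩ := twoSaturated_of_certB (scaleModel r.intModel c.d) hΔ e₁ e₂ e₃ hm htm
    hann hS hw₁ hw₂ hw₃ hw₁₂ hw₁₃ hw₂₃ hw₁₂₃
  -- the change of variables `(x, y) ↦ (d²x, d³y)` from `r.curve` to the scaled model over `ℚ`
  have hd' : (c.d : ℚ) ≠ 0 := by exact_mod_cast hd
  let C : VariableChange ℚ := ⟨(Units.mk0 (c.d : ℚ) hd')⁻¹, 0, 0, 0⟩
  have hVC : C • r.curve = (scaleModel r.intModel c.d).map (Int.castRingHom ℚ) := by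
    rw [r.curve_eq_map_intModel]
    exact (map_scaleModel_eq_smul r.intModel hd).symm
  let e : r.curve.toAffine.Point ≃+
      ((scaleModel r.intModel c.d).map (Int.castRingHom ℚ)).toAffine.Point :=
    (VariableChange.pointEquiv r.curve C).trans (Affine.Point.congrEquiv hVC)
  have hCx : ∀ x : ℚ, C.toX x = (c.d : ℚ) ^ 2 * x := by
    intro x
    simp only [VariableChange.toX_def, C, inv_inv, Units.val_mk0, sub_zero]
  have hCy : ∀ x y : ℚ, C.toY x y = (c.d : ℚ) ^ 3 * y := by
    intro x y
    simp only [VariableChange.toY_def, C, inv_inv, Units.val_mk0, sub_zero, zero_mul]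
  obtain ⟨-, hP₁, hP₂, hP₃, -⟩ := r.check_spec h
  have hZ₁ : r.P₁.2.2 ≠ 0 := (of_decide_eq_true hP₁).1
  have hZ₂ : r.P₂.2.2 ≠ 0 := (of_decide_eq_true hP₂).1
  have hZ₃ : r.P₃.2.2 ≠ 0 := (of_decide_eq_true hP₃).1
  have eg₁ : e (r.gen₁ h) =
      .some (c.X₁ : ℚ) (c.Y₁ : ℚ) (nonsingular_rat_of_eq _ hΔ e₁) := by
    simp only [e, AddEquiv.trans_apply, Rank3Row.gen₁, VariableChange.pointEquiv_some,
      Affine.Point.congrEquiv_some]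
    exact some_eq_some (by rw [hCx]; exact scaled_coord 2 hZ₁ hX₁)
      (by rw [hCy]; exact scaled_coord 3 hZ₁ hY₁)
  have eg₂ : e (r.gen₂ h) =
      .some (c.X₂ : ℚ) (c.Y₂ : ℚ) (nonsingular_rat_of_eq _ hΔ e₂) := by
    simp only [e, AddEquiv.trans_apply, Rank3Row.gen₂, VariableChange.pointEquiv_some,
      Affine.Point.congrEquiv_some]
    exact some_eq_some (by rw [hCx]; exact scaled_coord 2 hZ₂ hX₂)
      (by rw [hCy]; exact scaled_coord 3 hZ₂ hY₂)
  have eg₃ : e (r.gen₃ h) =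
      .some (c.X₃ : ℚ) (c.Y₃ : ℚ) (nonsingular_rat_of_eq _ hΔ e₃) := by
    simp only [e, AddEquiv.trans_apply, Rank3Row.gen₃, VariableChange.pointEquiv_some,
      Affine.Point.congrEquiv_some]
    exact some_eq_some (by rw [hCx]; exact scaled_coord 2 hZ₃ hX₃)
      (by rw [hCy]; exact scaled_coord 3 hZ₃ hY₃)
  have es₁ : e.symm (.some (c.X₁ : ℚ) (c.Y₁ : ℚ) (nonsingular_rat_of_eq _ hΔ e₁)) = r.gen₁ h := by
    rw [← eg₁, AddEquiv.symm_apply_apply]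
  have es₂ : e.symm (.some (c.X₂ : ℚ) (c.Y₂ : ℚ) (nonsingular_rat_of_eq _ hΔ e₂)) = r.gen₂ h := by
    rw [← eg₂, AddEquiv.symm_apply_apply]
  have es₃ : e.symm (.some (c.X₃ : ℚ) (c.Y₃ : ℚ) (nonsingular_rat_of_eq _ hΔ e₃)) = r.gen₃ h := by
    rw [← eg₃, AddEquiv.symm_apply_apply]
  have hsat' := two_saturated_map e.symm hsat
  have hli' := linearIndependent_triple_map e.symm hli
  rw [es₁, es₂, es₃] at hsat' hli'
  exact ⟨hsat', hli'⟩

/-- **Finite ODD index given `rank_ℤ E(ℚ) = 3`.** For a row with `2`-saturated listed span,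
`ℤ`-independent generators and `rank_ℤ E(ℚ) = 3` (the census
`…Rank3KernelRankCensusN9365.rank_eq_three`, 9 365 rows) the listed span
`ℤP₁ + ℤP₂ + ℤP₃ + E(ℚ)_tors` has finite index in `E(ℚ)` and the index is ODD
(`finiteIndex_listedSpan`, `odd_index_listedSpan`; Mordell–Weil `module_finite_point_holds`
proved in the tree): `Reg(P₁, P₂, P₃) = n² · Reg(E(ℚ)/tors)` with `n` odd.
[cite: CremonaAlgorithms1997, §3.5] [cite: SilvermanAEC2009, Thm. VIII.6.7] -/
theorem finiteIndex_and_odd_index_of_twoSaturated (r : Rank3Row) (h : r.check = true)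
    (hsat : ∀ a : r.curve.toAffine.Point,
      2 • a ∈ AddSubgroup.closure {r.gen₁ h, r.gen₂ h, r.gen₃ h} ⊔ AddCommGroup.torsion _ →
        a ∈ AddSubgroup.closure {r.gen₁ h, r.gen₂ h, r.gen₃ h} ⊔ AddCommGroup.torsion _)
    (hli : LinearIndependent ℤ ![r.gen₁ h, r.gen₂ h, r.gen₃ h])
    (hr : r.curve.mordellWeilRank = 3) :
    (AddSubgroup.closure {r.gen₁ h, r.gen₂ h, r.gen₃ h} ⊔ AddCommGroup.torsion _).FiniteIndex ∧
      Odd (AddSubgroup.closure {r.gen₁ h, r.gen₂ h, r.gen₃ h} ⊔ AddCommGroup.torsion _).index := by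
  haveI := r.isElliptic_of_delta_ne_zero (r.check_spec h).1
  haveI : Module.Finite ℤ r.curve.toAffine.Point := by convert r.curve.module_finite_point_holds
  have hfr : Module.finrank ℤ r.curve.toAffine.Point = 3 := by
    rw [← hr]; unfold WeierstrassCurve.mordellWeilRank; congr!
  haveI := finiteIndex_listedSpan hfr hli
  exact ⟨this, odd_index_listedSpan hsat⟩

end Rank3Row

/-! ### List form for the data files -/

/-- The row Boolean over a list of rows and a list of certificates (same order; `false` if the
certificates run out). [folklore] -/
def rank3SatCheckAll : List Rank3Row → List Rank3SatCert → Bool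
  | [], _ => true
  | _ :: _, [] => false
  | r :: rs, c :: cs => rank3SatCheck r c && rank3SatCheckAll rs cs

/-- **Soundness of the list form**: for every row of a passing list the listed span is
`2`-saturated and the generators are `ℤ`-independent. [cite: CremonaAlgorithms1997, §3.5] -/
theorem Rank3Row.twoSaturated_of_satCheckAll :
    ∀ {rows : List Rank3Row} {cs : List Rank3SatCert}, rank3SatCheckAll rows cs = true →
      ∀ r ∈ rows, ∀ h : r.check = true,
        (∀ a : r.curve.toAffine.Point,
          2 • a ∈ AddSubgroup.closure {r.gen₁ h, r.gen₂ h, r.gen₃ h} ⊔ AddCommGroup.torsion _ →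
            a ∈ AddSubgroup.closure {r.gen₁ h, r.gen₂ h, r.gen₃ h} ⊔ AddCommGroup.torsion _) ∧
        LinearIndependent ℤ ![r.gen₁ h, r.gen₂ h, r.gen₃ h]
  | [], _, _ => by simp
  | _ :: _, [], h => by simp [rank3SatCheckAll] at h
  | r :: rs, c :: cs, h => by
    rw [rank3SatCheckAll, Bool.and_eq_true] at h
    intro r' hr' h'
    rcases List.mem_cons.mp hr' with rfl | hr'
    · exact r'.twoSaturated_of_satCheck h' c h.1
    · exact Rank3Row.twoSaturated_of_satCheckAll h.2 r' hr' h'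

end Summit.BirchSwinnertonDyer.BirchSwinnertonDyer.Rank2Observatory
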